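import Summits.BirchSwinnertonDyer.BirchSwinnertonDyer.Theorems.ManinLocalTwoThreeRootSqueezeEleven
import Summits.BirchSwinnertonDyer.BirchSwinnertonDyer.Theorems.ManinLocalTwoThreeNeronSqueeze
import Literature.NumberTheory.Automorphic.ShimuraCurveRibetTakahashiOptimalModularityProofs
import Literature.NumberTheory.EllipticCurves.ModularSymbolsParabolicCohomology
import Literature.NumberTheory.EllipticCurves.NewformsStrongMultiplicityOne
import Literature.NumberTheory.EllipticCurves.Curve11aAnalyticRankZero
import Literature.NumberTheory.DiophantineGeometry.DenesEquationWeightTwoLevelsProofs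
import Literature.NumberTheory.EllipticCurves.Rank1Residual.X11RankOneCertificates.Minimality
import Literature.NumberTheory.EllipticCurves.HalfIntegralWeightForms
import HarnessLib

/-!
# THE ROOT INCLUSION AT LEVEL 11: `Λ₁₁(φ₁₁) ⊆ Λ_Néron(11a1)` and `|c| = 1` for every lattice-optimal `X₀(11)`-datum — fact-free

Cell `bsd-f2-manin`, route `ManinLocalTwoThree`; prover seat `bsd-manin-nonvacuity-1` (falsifier (a) NON-VACUITY of the 21-frontier ORDER
2026-08-31T18:22Z), `--supports` the rung `ManinConstantOneRung` (stmt-BirchSwinnertonDyer-22445).  The tree's (S2)₁₁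
(`RootSqueezeEleven.periodLatticeLe_iota_phi11`) squeezes only the `Γ₀(44)`-periods of the level-`44` lift of `φ₁₁ = η(τ)²η(11τ)²` into the Néron
lattice of `11a1 = [0,−1,1,−10,−20]` (the `℘`-coordinate has no `η`/Eisenstein presentation on `Γ₀(11)` itself).  GROUP-THEORETIC BYPASS:
`Γ₀(11) = Γ₀(44)·⟨T, U⟩` with `T = (1 1; 0 1)`, `U = (1 0; 11 1)` — every `γ ∈ Γ₀(11)` has `γTᵐUᵏ ∈ Γ₀(44)` for some `m < 2`, `k < 4` (a finite
check in `SL₂(ℤ/4ℤ)`, kernel `decide`) — and `T`, `U` are PARABOLIC, so their periods vanish (`cuspSymbol_eq_zero_of_discr_eq_zero`, Knapp Prop. 11.1);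
with Manin's homomorphism (`cuspSymbol_mul_holds`) `{∞, γ∞}_{φ₁₁} = {∞, (γTᵐUᵏ)∞} ∈ Λ₄₄(ι₁φ₁₁) ⊆ Λ_Néron(11a1)`.

* §1 `φ₁₁` is a newform on `Γ₀(11)` fact-free (`isNewform0_phi11`: new since `S₂(Γ₀(1)) = 0`, eigen since `dim S₂(Γ₀(11)) = 1`, `a₁ = 1` by the
  certified table) and every `X₀(11)`-datum of every curve has `D.f = φ₁₁`; `11a1` is globally minimal, `N(11a1) = 11` (tree).
* §2 `Γ₀(11) = Γ₀(44)·⟨T, U⟩` (`exists_mul_mem_Gamma0_fortyFour`).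
* §3 **`periodLattice_phi11_le`: `Λ₁₁(φ₁₁) ⊆ Λ(L₀)` for every Néron pair `L₀` of `11a1`** — UNCONDITIONAL.
* §4 **`abs_maninConstant_eq_one_eleven`: every lattice-optimal `X₀(11)`-datum of every globally minimal elliptic `W/ℚ` has `|c| = 1`** (the tree's
  Néron squeeze `NeronSqueeze.abs_maninConstant_eq_one_of_periodLattice_le` fed with §3) — the body of the rung at `N = 11` with NO hypothesis, NO
  UDC/CDT; `nonempty_datum_eleven_iff`: a datum of `11a1` at level `11` exists IFF `aₙ(φ₁₁) = aₙ(11a1)` for all `n` (Eichler–Shimura for `X₀(11)`,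
  not in the tree), every OTHER field being dischargeable fact-free with `c = 1` (`fields_except_isNewformOf_eleven`); given the Modularity fact
  `exists_isNewformOf` alone, a lattice-optimal datum with `f = φ₁₁`, `|c| = 1` exists on a globally minimal curve of the class `11a`
  (`exists_latticeOptimalDatum_eleven_of_modularity`, CONDITIONAL).

HONEST FRAMING: §1–§4 except the last theorem are unconditional (standard axioms); nothing here decides WHICH curve of the class `{11a1, 11a2, 11a3}`
is `X₀(11)`-optimal (the lattice clause for a datum OF `11a1`, i.e. `deg = 1`, is not proved); nothing here proves the `∀ N` rung, Manin's conjecture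
or BSD.  No named fact introduced, no sorry. [cite: Knapp1993, Prop. 11.1] [cite: Manin1972, Prop. 1.4] [cite: CremonaAlgorithms1997, Table 1 (11a1)]
[cite: AgasheRibetStein2006, §§1–2] [cite: DiamondShurman2005, Prop. 3.2.2]
-/

set_option autoImplicit false
-- lint-debt: the directory name repeats the summit name (sibling precedent `ManinLocalTwoThreeRootSqueezeEleven.lean`)
set_option linter.dupNamespace false

noncomputable section

open scoped MatrixGroups ModularForm
open CongruenceSubgroup WeierstrassCurve
open Literature.NumberTheory.EllipticCurves Literature.NumberTheory.EllipticCurves.ModularForms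
open Literature.NumberTheory.Automorphic
open Literature.NumberTheory.ModularForms

namespace Summit.BirchSwinnertonDyer.BirchSwinnertonDyer.Theorems.ManinLocalTwoThree.RootInclusionEleven

open Summit.BirchSwinnertonDyer.BirchSwinnertonDyer.Theorems.ManinLocalTwoThree

/-! ## §1 `11a1`, and `φ₁₁ = η(τ)²η(11τ)²` is THE newform on `Γ₀(11)` — fact-free -/

/-- `11a1 = [0, −1, 1, −10, −20]` is a global minimal model (Silverman's integer criterion: `Δ = −11⁵`, `c₄ = 496`).
[cite: SilvermanAEC2009, VII.1 Remark 1.1] -/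
theorem isGloballyMinimal_curve11A1 : X1Eleven.curve11A1.IsGloballyMinimal :=
  Rank1Residual.X11RankOneCertificates.isGloballyMinimal_of_int_criterion 0 (-1) 1 (-10) (-20)
    (Rank1Residual.X11RankOneCertificates.Record.criterion_of_minCheck (by decide +kernel) (by decide +kernel) (by decide +kernel))

/-- Every `f ∈ S₂(Γ₀(11))` is new: the adjoint degeneracy maps land in `S₂(Γ₀(1)) = 0`. [cite: DiamondShurman2005, Prop. 3.2.2] -/
theorem mem_newSubspace0_eleven (f : CuspForm (Gamma0 11) 2) : f ∈ newSubspace0 11 2 := by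
  rw [newSubspace0, Submodule.mem_iInf]
  intro Md
  rw [LinearMap.mem_ker]
  have hall : ∀ M ∈ Nat.properDivisors 11, M ∣ 16 := by decide
  exact Literature.NumberTheory.DiophantineGeometry.cuspForm_two_gamma0_eq_zero_of_dvd_sixteen (hall _ Md.2.1) _

/-- `φ₁₁` is a Hecke eigenform (`S₂(Γ₀(11)) = ℂφ₁₁` is `T_p`-stable). [cite: DiamondShurman2005, Prop. 3.2.2] -/
theorem isHeckeEigenform_phi11 : IsHeckeEigenform cuspFormEtaProductEleven := by
  intro p hp
  haveI : NeZero p := ⟨hp.ne_zero⟩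
  obtain ⟨c, hc⟩ := finrank_cuspForm_two_eq_genusX0_eleven.2.2 (heckeT _ 2 p cuspFormEtaProductEleven)
  exact ⟨c, hc.symm⟩

/-- `a₁(φ₁₁) = 1` (entry `1` of the certified sparse `η`-table `RootSqueezeEleven.cF`). [cite: Koehler2011, §2.1] -/
theorem cuspCoeff_phi11_one : cuspCoeff cuspFormEtaProductEleven 1 = 1 := by
  have h := BracketSturm.qExpansion_coeff_eq_of_etaCertificateSparse_cuspForm cuspFormEtaProductEleven
    (expFn [(1, 2), (11, 2)]) PinningOneSeventySix.phi11_eq_etaQuotient 1 PinningOneSeventySix.hS.1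
    RootSqueezeEleven.cF RootSqueezeEleven.hcertPhi11D 1 (by norm_num)
  have h1 : RootSqueezeEleven.cF.getD 1 0 = 1 := by decide
  rw [h1] at h
  unfold cuspCoeff
  exact_mod_cast h.symm

/-- **`φ₁₁ = η(τ)²η(11τ)²` is a newform on `Γ₀(11)`** (new, eigen, `a₁ = 1`) — fact-free. [cite: DiamondShurman2005, Prop. 3.2.2] -/
theorem isNewform0_phi11 : IsNewform0 cuspFormEtaProductEleven :=
  ⟨mem_newSubspace0_eleven _, isHeckeEigenform_phi11, cuspCoeff_phi11_one⟩

/-- Every newform of weight `2` on `Γ₀(11)` is `φ₁₁` (one normalised form in the line `S₂(Γ₀(11))`). [cite: DiamondShurman2005, Prop. 3.2.2] -/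
theorem eq_phi11_of_isNewform0 {g : CuspForm (Gamma0 11) 2} (hg : IsNewform0 g) : g = cuspFormEtaProductEleven := by
  obtain ⟨c, hc⟩ := finrank_cuspForm_two_eq_genusX0_eleven.2.2 g
  have h1 : cuspCoeff g 1 = 1 := hg.2.2
  have hc1 : c = 1 := by
    have h := congrArg (cuspCoeff · 1) hc
    simp only [cuspCoeff_smul, cuspCoeff_phi11_one, mul_one] at h
    rw [h, h1]
  rw [← hc, hc1, one_smul]

/-- Every `X₀(11)`-parametrisation datum of ANY curve has newform `φ₁₁`. [folklore] -/
theorem datum_eleven_f {W : WeierstrassCurve ℚ} (D : ModularParametrizationData W 11) : D.f = cuspFormEtaProductEleven :=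
  eq_phi11_of_isNewform0 D.isNewformOf.1

/-! ## §2 `Γ₀(11) = Γ₀(44)·⟨T, U⟩` with `T = (1 1; 0 1)`, `U = (1 0; 11 1) = (T¹¹)ᵀ` parabolic -/

/-- `U = (T¹¹)ᵀ = (1 0; 11 1) ∈ Γ₀(11)`. [folklore] -/
theorem U11_mem_Gamma0 : Matrix.SpecialLinearGroup.transpose (ModularGroup.T ^ 11) ∈ Gamma0 11 := by
  rw [Gamma0_mem]; decide +kernel

/-- `T` is parabolic: `tr(T)² − 4 det(T) = 0`. [folklore] -/
theorem discr_T : ((ModularGroup.T : SL(2, ℤ)) : Matrix (Fin 2) (Fin 2) ℤ).discr = 0 := by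
  rw [Matrix.discr_fin_two, Matrix.trace_fin_two, Matrix.det_fin_two]
  simp [ModularGroup.coe_T]

/-- `U = (1 0; 11 1)` is parabolic: `tr(U)² − 4 det(U) = 0`. [folklore] -/
theorem discr_U11 : ((Matrix.SpecialLinearGroup.transpose (ModularGroup.T ^ 11) : SL(2, ℤ)) : Matrix (Fin 2) (Fin 2) ℤ).discr = 0 := by
  rw [Matrix.discr_fin_two, Matrix.trace_fin_two, Matrix.det_fin_two]
  decide +kernel

/-- In `SL₂(ℤ/4ℤ)` every element is moved into the Borel `{c = 0}` by right multiplication with `T̄ᵐŪᵏ`, `m < 2`, `k < 4`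
(`T̄`, `Ū` the reductions of `T`, `U`; kernel computation over the `48` elements). [folklore] -/
theorem sl2_zmod4_reduce : ∀ A : SL(2, ZMod 4), ∃ m : Fin 2, ∃ k : Fin 4,
    ((A * Matrix.SpecialLinearGroup.map (Int.castRingHom (ZMod 4)) ModularGroup.T ^ (m : ℕ) *
        Matrix.SpecialLinearGroup.map (Int.castRingHom (ZMod 4)) (Matrix.SpecialLinearGroup.transpose (ModularGroup.T ^ 11)) ^ (k : ℕ) : SL(2, ZMod 4)) :
      Matrix (Fin 2) (Fin 2) (ZMod 4)) 1 0 = 0 := by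
  decide +kernel

/-- **`Γ₀(11) = Γ₀(44)·⟨T, U⟩`**: every `γ ∈ Γ₀(11)` has `γTᵐUᵏ ∈ Γ₀(44)` for some `m, k` (`11 ∣ c` is automatic, `4 ∣ c` by `sl2_zmod4_reduce`).
[folklore] -/
theorem exists_mul_mem_Gamma0_fortyFour (γ : SL(2, ℤ)) (hγ : γ ∈ Gamma0 11) :
    ∃ m k : ℕ, γ * ModularGroup.T ^ m * (Matrix.SpecialLinearGroup.transpose (ModularGroup.T ^ 11)) ^ k ∈ Gamma0 44 := by
  obtain ⟨m, k, hmk⟩ := sl2_zmod4_reduce (Matrix.SpecialLinearGroup.map (Int.castRingHom (ZMod 4)) γ)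
  refine ⟨m, k, ?_⟩
  set g : SL(2, ℤ) := γ * ModularGroup.T ^ (m : ℕ) * (Matrix.SpecialLinearGroup.transpose (ModularGroup.T ^ 11)) ^ (k : ℕ) with hg
  have hg11 : g ∈ Gamma0 11 :=
    Subgroup.mul_mem _ (Subgroup.mul_mem _ hγ (Subgroup.pow_mem _ (modularT_mem_Gamma0 11) _)) (Subgroup.pow_mem _ U11_mem_Gamma0 _)
  have h11 : (11 : ℤ) ∣ g 1 0 := by
    rw [Gamma0_mem, ZMod.intCast_zmod_eq_zero_iff_dvd] at hg11
    exact_mod_cast hg11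
  have h4 : (4 : ℤ) ∣ g 1 0 := by
    have hr : Matrix.SpecialLinearGroup.map (Int.castRingHom (ZMod 4)) g =
        Matrix.SpecialLinearGroup.map (Int.castRingHom (ZMod 4)) γ * Matrix.SpecialLinearGroup.map (Int.castRingHom (ZMod 4)) ModularGroup.T ^ (m : ℕ) *
          Matrix.SpecialLinearGroup.map (Int.castRingHom (ZMod 4)) (Matrix.SpecialLinearGroup.transpose (ModularGroup.T ^ 11)) ^ (k : ℕ) := by
      rw [hg, map_mul, map_mul, map_pow, map_pow]
    have h10 : ((Matrix.SpecialLinearGroup.map (Int.castRingHom (ZMod 4)) g) : Matrix (Fin 2) (Fin 2) (ZMod 4)) 1 0 = 0 := by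
      rw [hr]; exact hmk
    exact (ZMod.intCast_zmod_eq_zero_iff_dvd _ 4).mp h10
  rw [Gamma0_mem, ZMod.intCast_zmod_eq_zero_iff_dvd]
  have h44 : ((44 : ℕ) : ℤ) = 4 * 11 := by norm_num
  rw [h44]
  exact (Int.isCoprime_iff_gcd_eq_one.mpr (by norm_num)).mul_dvd h4 h11

/-! ## §3 The root inclusion `Λ₁₁(φ₁₁) ⊆ Λ_Néron(11a1)` -/

/-- `{∞, γⁿ∞}_f = n·{∞, γ∞}_f` (Manin: `γ ↦ {∞, γ∞}_f` is a homomorphism, tree `cuspSymbol_mul_holds`). [cite: Manin1972, Prop. 1.4] -/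
theorem cuspSymbol_pow {N : ℕ} [NeZero N] (f : CuspForm (Gamma0 N) 2) (γ : Gamma0 N) (n : ℕ) :
    cuspSymbol f (γ ^ n) = n * cuspSymbol f γ := by
  have H : ∀ γ δ : Gamma0 N, cuspSymbol f (γ * δ) = cuspSymbol f γ + cuspSymbol f δ := cuspSymbol_mul_holds f
  induction n with
  | zero => simp
  | succ n ih => rw [pow_succ, H, ih]; push_cast; ring

/-- The `Γ₀(44)`-cusp symbols of the level-`44` lift `ι₁φ₁₁` are cusp symbols of `φ₁₁` (same function on `ℍ`, `coe_degeneracyMap0_one`).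
[cite: DiamondShurman2005, §5.6 Exercise 5.6.1] -/
theorem cuspSymbol_iota_phi11 (δ : Gamma0 44) (h11 : (δ : SL(2, ℤ)) ∈ Gamma0 11) :
    cuspSymbol (degeneracyMap0 11 44 1 2 cuspFormEtaProductEleven) δ = cuspSymbol cuspFormEtaProductEleven ⟨δ, h11⟩ := by
  unfold cuspSymbol modularSymbol
  simp only [coe_degeneracyMap0_one 11 44 2 ⟨4, rfl⟩]

/-- **THE ROOT INCLUSION AT LEVEL 11: `Λ₁₁(φ₁₁) ⊆ Λ_Néron(11a1)`** — the `Γ₀(11)`-period lattice of `η(τ)²η(11τ)²` lies in every Néron lattice of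
`11a1 = [0,−1,1,−10,−20]`.  UNCONDITIONAL.  (`Γ₀(11) = Γ₀(44)·⟨T, U⟩`, periods of the parabolics `T`, `U` vanish, Manin's homomorphism, and the
tree's (S2)₁₁ `RootSqueezeEleven.periodLatticeLe_iota_phi11` for the `Γ₀(44)`-words.) [cite: Knapp1993, Prop. 11.1] [cite: Manin1972, Prop. 1.4]
[cite: CremonaAlgorithms1997, Table 1 (11a1)] -/
theorem periodLattice_phi11_le {L₀ : PeriodPair} (hL₀ : IsNeronLatticeOf (X1Eleven.curve11A1.baseChange ℂ) L₀) :
    ∀ z ∈ periodLattice cuspFormEtaProductEleven, z ∈ L₀.lattice := by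
  have H : ∀ γ δ : Gamma0 11, cuspSymbol cuspFormEtaProductEleven (γ * δ) =
      cuspSymbol cuspFormEtaProductEleven γ + cuspSymbol cuspFormEtaProductEleven δ := cuspSymbol_mul_holds _
  set t : Gamma0 11 := ⟨ModularGroup.T, modularT_mem_Gamma0 11⟩ with ht
  set u : Gamma0 11 := ⟨Matrix.SpecialLinearGroup.transpose (ModularGroup.T ^ 11), U11_mem_Gamma0⟩ with hu
  have hT : cuspSymbol cuspFormEtaProductEleven t = 0 := cuspSymbol_eq_zero_of_discr_eq_zero _ discr_T
  have hU : cuspSymbol cuspFormEtaProductEleven u = 0 := cuspSymbol_eq_zero_of_discr_eq_zero _ discr_U11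
  intro z hz
  refine AddSubgroup.closure_induction (fun x hx ↦ ?_) (zero_mem _) (fun x y _ _ hx hy ↦ add_mem hx hy)
    (fun x _ hx ↦ neg_mem hx) hz
  obtain ⟨γ, rfl⟩ := hx
  obtain ⟨m, k, hmem⟩ := exists_mul_mem_Gamma0_fortyFour (γ : SL(2, ℤ)) γ.2
  have hprod : ((γ * t ^ m * u ^ k : Gamma0 11) : SL(2, ℤ)) =
      (γ : SL(2, ℤ)) * ModularGroup.T ^ m * (Matrix.SpecialLinearGroup.transpose (ModularGroup.T ^ 11)) ^ k := by
    rw [Subgroup.coe_mul, Subgroup.coe_mul, Subgroup.coe_pow, Subgroup.coe_pow]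
  have hmem' : ((γ * t ^ m * u ^ k : Gamma0 11) : SL(2, ℤ)) ∈ Gamma0 44 := by rw [hprod]; exact hmem
  have hγ : cuspSymbol cuspFormEtaProductEleven γ = cuspSymbol cuspFormEtaProductEleven (γ * t ^ m * u ^ k) := by
    rw [H, H, cuspSymbol_pow, cuspSymbol_pow, hT, hU]; ring
  have hδ : cuspSymbol cuspFormEtaProductEleven (γ * t ^ m * u ^ k) =
      cuspSymbol (degeneracyMap0 11 44 1 2 cuspFormEtaProductEleven) ⟨((γ * t ^ m * u ^ k : Gamma0 11) : SL(2, ℤ)), hmem'⟩ := by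
    rw [cuspSymbol_iota_phi11]
  rw [hγ, hδ]
  exact RootSqueezeEleven.periodLatticeLe_iota_phi11 hL₀ _ (cuspSymbol_mem_periodLattice _ _)

/-! ## §4 `|c| = 1` for every lattice-optimal `X₀(11)`-datum — the rung at `N = 11`, fact-free -/

/-- **`|c| = 1` for EVERY lattice-optimal `X₀(11)`-datum of EVERY globally minimal elliptic `W/ℚ` — UNCONDITIONAL** (the tree's Néron squeeze
`NeronSqueeze.abs_maninConstant_eq_one_of_periodLattice_le` with `W₀ = 11a1` and the root inclusion `periodLattice_phi11_le`; `D.f = φ₁₁` by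
`datum_eleven_f`). [cite: AgasheRibetStein2006, §§1–2] [cite: CremonaAlgorithms1997, Table 1 (11a1)] -/
theorem abs_maninConstant_eq_one_eleven (W : WeierstrassCurve ℚ) [W.IsElliptic] [W.IsGloballyMinimal]
    (D : ModularParametrizationData W 11) (hopt : ∀ z ∈ D.L.lattice, ∃ w ∈ periodLattice D.f, z = D.c * w) :
    |D.maninConstant| = 1 := by
  haveI : X1Eleven.curve11A1.IsElliptic := RootSqueezeEleven.isElliptic_elevenA1
  haveI : (X1Eleven.curve11A1.baseChange ℂ).IsElliptic := by rw [WeierstrassCurve.baseChange]; infer_instance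
  haveI := isGloballyMinimal_curve11A1
  obtain ⟨L₀, hL₀⟩ := exists_isNeronLatticeOf_holds (X1Eleven.curve11A1.baseChange ℂ)
  have hS2 : ∀ z ∈ periodLattice D.f, z ∈ L₀.lattice := by
    rw [datum_eleven_f D]; exact periodLattice_phi11_le hL₀
  exact NeronSqueeze.abs_maninConstant_eq_one_of_periodLattice_le X1Eleven.curve11A1 L₀ hL₀ W D hS2 hopt

/-- **The body of the rung `ManinConstantOneRung` / the leaf `ManinConstantOne` at the single level `N = 11`, with NO hypothesis.**
[cite: AgasheRibetStein2006, §§1–2] -/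
theorem maninConstantOne_at_eleven :
    ∀ (W : WeierstrassCurve ℚ) [W.IsElliptic] [W.IsGloballyMinimal] (D : ModularParametrizationData W 11),
      (∀ z ∈ D.L.lattice, ∃ w ∈ periodLattice D.f, z = D.c * w) → |D.maninConstant| = 1 :=
  fun W _ _ D hopt ↦ abs_maninConstant_eq_one_eleven W D hopt

/-- No prime divides the Manin constant of a lattice-optimal `X₀(11)`-datum. [folklore] -/
theorem not_dvd_maninConstant_eleven (W : WeierstrassCurve ℚ) [W.IsElliptic] [W.IsGloballyMinimal]
    (D : ModularParametrizationData W 11) (hopt : ∀ z ∈ D.L.lattice, ∃ w ∈ periodLattice D.f, z = D.c * w)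
    {p : ℕ} (hp : p.Prime) : ¬ (p : ℤ) ∣ D.maninConstant := by
  intro hdvd
  have h1 := abs_maninConstant_eq_one_eleven W D hopt
  have hle := Int.le_of_dvd (by rw [h1]; norm_num) ((dvd_abs _ _).mpr hdvd)
  rw [h1] at hle
  have := hp.two_le
  omega

/-- **Every field of `ModularParametrizationData 11a1 11` except `isNewformOf` is dischargeable fact-free, with `f = φ₁₁` and `c = 1`**:
Néron period pair (`exists_isNeronLatticeOf_holds`), uniformisation with kernel `Λ` and the `℘`-formula (`IsNeronLatticeOf.exists_uniformize_holds`),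
`1·Λ₁₁(φ₁₁) ⊆ Λ` (`periodLattice_phi11_le`), degree (`exists_modularDegree_holds`). [cite: SilvermanAEC2009, Prop. VI.3.6(b), Thm. VI.5.1] -/
theorem fields_except_isNewformOf_eleven :
    ∃ (L : PeriodPair) (u : ℂ →+ (X1Eleven.curve11A1.baseChange ℂ).toAffine.Point) (deg : ℕ),
      IsNeronLatticeOf (X1Eleven.curve11A1.baseChange ℂ) L ∧ (u.ker : Set ℂ) = L.lattice ∧ Function.Surjective u ∧
      (∀ z ∉ L.lattice, ∃ h, u z = .some (W' := (X1Eleven.curve11A1.baseChange ℂ).toAffine)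
          (L.weierstrassP z - (X1Eleven.curve11A1.baseChange ℂ).b₂ / 12)
          ((L.derivWeierstrassP z - (X1Eleven.curve11A1.baseChange ℂ).a₁ * (L.weierstrassP z - (X1Eleven.curve11A1.baseChange ℂ).b₂ / 12)
            - (X1Eleven.curve11A1.baseChange ℂ).a₃) / 2) h) ∧
      (∀ z ∈ periodLattice cuspFormEtaProductEleven, ((1 : ℤ) : ℂ) * z ∈ L.lattice) ∧ 0 < deg ∧
      {P : (X1Eleven.curve11A1.baseChange ℂ).toAffine.Point |
        Nat.card {y : Y0 11 // ∃ τ : UpperHalfPlane, Y0.mk 11 τ = y ∧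
          u (((1 : ℤ) : ℂ) * eichlerIntegral cuspFormEtaProductEleven τ) = P} ≠ deg}.Finite := by
  haveI : X1Eleven.curve11A1.IsElliptic := RootSqueezeEleven.isElliptic_elevenA1
  haveI : (X1Eleven.curve11A1.baseChange ℂ).IsElliptic := by rw [WeierstrassCurve.baseChange]; infer_instance
  obtain ⟨L, hL⟩ := exists_isNeronLatticeOf_holds (X1Eleven.curve11A1.baseChange ℂ)
  have hc : ∀ z ∈ periodLattice cuspFormEtaProductEleven, ((1 : ℤ) : ℂ) * z ∈ L.lattice := fun z hz ↦ by
    rw [Int.cast_one, one_mul]; exact periodLattice_phi11_le hL z hz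
  obtain ⟨u, hker, hsurj, hspec⟩ := IsNeronLatticeOf.exists_uniformize_holds hL
  obtain ⟨d, hd, hfin⟩ := exists_modularDegree_holds cuspFormEtaProductEleven_ne_zero (L := L) (c := ((1 : ℤ) : ℂ))
    (by norm_num) hc
  have hker' : L.lattice.toAddSubgroup = u.ker :=
    SetLike.coe_injective (by rw [Submodule.coe_toAddSubgroup, hker])
  let e : ℂ ⧸ L.lattice.toAddSubgroup ≃+ (X1Eleven.curve11A1.baseChange ℂ).toAffine.Point :=
    QuotientAddGroup.liftEquiv L.lattice.toAddSubgroup hsurj hker'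
  have he : ∀ x : ℂ, e.toEquiv (x : ℂ ⧸ L.lattice.toAddSubgroup) = u x := fun _ ↦ rfl
  have key := (finite_setOf_card_fiberOrbits_ne_iff e.toEquiv
    (fun τ : UpperHalfPlane ↦
      ((((1 : ℤ) : ℂ) * eichlerIntegral cuspFormEtaProductEleven τ : ℂ) : ℂ ⧸ L.lattice.toAddSubgroup)) d).mpr hfin
  simp only [he] at key
  exact ⟨L, u, d, hL, hker, hsurj, hspec, hc, hd, key⟩

/-- **EXACT RESIDUAL.**  A datum of `11a1` at level `11` exists IFF the Eichler–Shimura coefficient identity `aₙ(φ₁₁) = aₙ(11a1)` holds for all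
`n` (then with `f = φ₁₁`, `c = 1`); that identity (Eichler 1954 / Shimura 1971 Thm. 7.9, Cor. 7.10) is NOT proved in the tree — it is an instance
of the named fact `exists_isNewformOf`. [cite: DiamondShurman2005, Thm. 8.8.3] -/
theorem nonempty_datum_eleven_iff :
    Nonempty (ModularParametrizationData X1Eleven.curve11A1 11) ↔
      ∀ n : ℕ, cuspCoeff cuspFormEtaProductEleven n = (X1Eleven.curve11A1.LFunction n : ℂ) := by
  refine ⟨fun ⟨D⟩ n ↦ ?_, fun h ↦ ?_⟩
  · rw [← datum_eleven_f D]; exact D.isNewformOf.2 n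
  · obtain ⟨L, u, d, hL, hker, hsurj, hspec, hc, hd, key⟩ := fields_except_isNewformOf_eleven
    exact ⟨{ f := cuspFormEtaProductEleven, isNewformOf := ⟨isNewform0_phi11, h⟩, L := L, isNeronLattice := hL, uniformize := u,
             ker_uniformize := hker, uniformize_surjective := hsurj, uniformize_spec := hspec, c := 1, smul_periodLattice_le := hc,
             deg := d, deg_pos := hd, deg_spec := key }⟩

/-- **GIVEN the Modularity fact `exists_isNewformOf` ALONE (no UDC/CDT): a lattice-optimal `X₀(11)`-datum with `f = φ₁₁` and `|c| = 1` exists on a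
globally minimal curve of the isogeny class of `11a1`** (`exists_optimal_modularParametrizationData_of_isNewformOf'` + `latticeEq_of_forall_modularDegree_le`
+ `abs_maninConstant_eq_one_eleven`).  CONDITIONAL; which curve of the class carries it is not decided here.
[cite: DiamondShurman2005, Thm. 8.8.3] [cite: Knapp1993, Prop. 12.9(a) and p. 302] -/
theorem exists_latticeOptimalDatum_eleven_of_modularity (hnf : exists_isNewformOf) :
    ∃ (W₀ : WeierstrassCurve ℚ) (_ : W₀.IsElliptic) (_ : W₀.IsGloballyMinimal) (D₀ : ModularParametrizationData W₀ 11),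
      D₀.f = cuspFormEtaProductEleven ∧ X1Eleven.curve11A1.IsIsogenous W₀ ∧
        (∀ z ∈ D₀.L.lattice, ∃ w ∈ periodLattice D₀.f, z = D₀.c * w) ∧ |D₀.maninConstant| = 1 := by
  haveI : X1Eleven.curve11A1.IsElliptic := RootSqueezeEleven.isElliptic_elevenA1
  haveI := isGloballyMinimal_curve11A1
  haveI := Curve11a.neZero_conductorNorm_curve11A1
  have hf : IsNewformOf X1Eleven.curve11A1 cuspFormEtaProductEleven := by
    have key : ∀ {M : ℕ} [NeZero M], M = 11 → (∃ g : CuspForm (Gamma0 M) 2, IsNewformOf X1Eleven.curve11A1 g) →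
        IsNewformOf X1Eleven.curve11A1 cuspFormEtaProductEleven := by
      rintro M _ rfl ⟨g, hg⟩
      obtain rfl := eq_phi11_of_isNewform0 hg.1
      exact hg
    exact key Curve11a.conductorNorm_curve11A1 (hnf X1Eleven.curve11A1)
  obtain ⟨W₀, hE₀, hM₀, D₀, hf₀, hiso, hmin⟩ := exists_optimal_modularParametrizationData_of_isNewformOf' 11 X1Eleven.curve11A1
    Curve11a.conductorNorm_curve11A1 hf
  haveI := hE₀
  haveI := hM₀
  have hopt : ∀ z ∈ D₀.L.lattice, ∃ w ∈ periodLattice D₀.f, z = D₀.c * w :=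
    D₀.latticeEq_of_forall_modularDegree_le (by simpa [hf₀] using hmin)
  exact ⟨W₀, hE₀, hM₀, D₀, hf₀, hiso, hopt, abs_maninConstant_eq_one_eleven W₀ D₀ hopt⟩

end Summit.BirchSwinnertonDyer.BirchSwinnertonDyer.Theorems.ManinLocalTwoThree.RootInclusionEleven

end
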